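import Summits.Ventures.Crystal3D.Theorems.StickyWulffConstantGenericWallFloorConeCertificateFanA
import HarnessLib

/-!
# FAN cone certificates: a fan of tangent test directions per free ball (×1.28–1.39 larger tube radii) — part B (covering step, fan sectors)

Helper for `stmt-Ventures-19480` (E1 inside-tube half; lit g12, LIT §36(D)).  The landed `ConeCert`
tests the first-order margin in the four signed directions `±τ₀, ±τ₁` of an integer orthogonal tangent
frame and loses the covering constant `1/√2` (every tangent `w` is within `45°` of one of them).  A
`FanCert` carries, per free ball, LP certificates for a FAN of integer directions
`±α_k τ₀ ± β_k τ₁`, `(α_k, β_k)` running from `(1,0)` to `(0,1)` with increasing slope; every tangent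
`w` lies in the cone of two CONSECUTIVE signed directions (`fan_coeffs`: sign flags put `w` in the first
quadrant, a discrete intermediate-value step finds the sector), and for the better of the two,
`cover_two` — purely algebraic: `W = xP + yQ`, `x, y ≥ 0` ⇒ `max(Ŵ·P̂, Ŵ·Q̂)² ≥ (1 + P̂·Q̂)/2` — gives
`Cd ‖w‖² ‖D‖² ≤ Cn ⟪w, D⟫²` with the certificate's rational covering constant `c² ≥ Cd/Cn`, checked in
integers per consecutive pair (`(2Cd − Cn)² |D_k|²|D_k'|² ≤ Cn² (D_k·D_k')²`, `D_k·D_l = α_kα_l|τ₀|² +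
β_kβ_l|τ₁|²`).  Own contacts are in the OBSTACLE-general form `2·slot·P = P·P` (unit own balls:
`P·P = N`), second-order weight `B_N = Σ_own λ (P·P) + 6N Λ_free`, and the per-ball radius check is
`ρ_i² (Cn B_N² + 4N Cd r² |D|²) ≤ 16 N Cd r² |D|²` for every fan direction `D` at ball `i`
(`FanCert.rhoCheckAt`; for `Cn/Cd = 2` and an orthogonal pair this is the landed `rhoCheck`).
THEOREMS: `FanCert.eq_slots_rhoAt` / `eq_slots_rhoAt_dist` (check ∧ ∀ i, rhoCheckAt i (p i) q ⇒ every
admissible completion with ball `i` within chord `p i / q` of slot `i` IS the slot configuration),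
`FanCert.eq_slotSet_of_slotMatched` (finset form in the `SlotMatched` currency of
`…ConeCertificateRhoPerBall`, feeding `exactOnly_of_slotTube_and_exhaustion`).
NUMBERS (exact, `cert/gencert_fan.py`, K = 12 directions, Cd/Cn = 9866/10000; kernel-checked data files
`…ConeCertFan{Fcc55,Hcp451,Hcp1743,Hcp1735,Hcp615,Hcp719,Hcp1739}`), per-ball radii FAN vs the landed per-ball
`…ConeCertRhoAt*` (orthogonal pair): C12-55 (0.104, 0.193, 0.193, 0.104, 0.193, 0.193, 0.280) vs (0.074, 0.141, 0.141,
0.074, 0.141, 0.141, 0.201); A12-451 (0.144, 0.152, 0.152, 0.144, 0.147, 0.135, 0.135) vs (0.108, 0.115, 0.115, 0.108,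
0.106, 0.096, 0.133); A12-1743 (0.393, 0.393, 0.204, 0.204) vs (0.282, 0.282, 0.145, 0.167); A12-1735 (0.241, 0.280,
0.256, 0.175, 0.175) vs (0.175, 0.201, 0.199, 0.127, 0.132); A12-615 (0.280, 0.280, 0.153, 0.153, 0.153, 0.153) vs
(0.201, 0.201, 0.114, 0.114, 0.114, 0.125); A12-719 min 0.161 vs 0.119; A12-1739 min 0.204 vs 0.145 (×1.35–1.41 on
the binding ball).  lit g12 (crystal3d-full; HOME/cf-lit/lean/conecert-fan/).

WHAT THIS IS NOT: the exhaustion outside the tube (eng lineage B / cf-p2 lineage A); rung F-C1 not moved.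
-/

noncomputable section

namespace Summit.Ventures.Crystal3D.Theorems

open Finset Literature.Geometry.DiscreteGeometry
open scoped RealInnerProductSpace

namespace FanCert

variable {m : ℕ} (C : FanCert m)

/-- The content of `check` as a proposition. -/
theorem check_spec (hV : C.check = true) :
    0 < C.N ∧ 2 ≤ C.K ∧ 0 < C.Cn ∧ 0 < C.Cd ∧
    (∀ i : Fin m, dotInt (C.slot i) (C.slot i) = C.N) ∧
    (∀ c : Fin C.nO, 2 * dotInt (C.slot (C.ownBall c)) (C.ownVec c) = dotInt (C.ownVec c) (C.ownVec c)) ∧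
    (∀ c : Fin C.nF, C.freeA c ≠ C.freeB c ∧ 2 * dotInt (C.slot (C.freeA c)) (C.slot (C.freeB c)) = C.N) ∧
    (∀ i : Fin m, C.slot i ≠ 0 ∧ C.tau i 0 ≠ 0 ∧ C.tau i 1 ≠ 0 ∧
      dotInt (C.slot i) (C.tau i 0) = 0 ∧ dotInt (C.slot i) (C.tau i 1) = 0 ∧
      dotInt (C.tau i 0) (C.tau i 1) = 0) ∧
    (∀ k : Fin C.K, (k.val = 0 → C.alpha k = 1 ∧ C.beta k = 0) ∧
      (k.val = C.K - 1 → C.alpha k = 0 ∧ C.beta k = 1)) ∧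
    (∀ k k' : Fin C.K, k'.val = k.val + 1 →
      C.alpha k' * C.beta k < C.alpha k * C.beta k' ∧
      (∀ i : Fin m, 2 * C.Cd ≤ C.Cn ∨
        (2 * (C.Cd : ℤ) - C.Cn) ^ 2 * C.ddot i k k * C.ddot i k' k' ≤ (C.Cn : ℤ) ^ 2 * (C.ddot i k k') ^ 2)) ∧
    (∀ i₀ : Fin m, ∀ k : Fin C.K, ∀ s0 s1 : Bool,
      0 < C.r i₀ k s0 s1 ∧
      (∀ i : Fin m, C.grad i₀ k s0 s1 i =
        C.mu i₀ k s0 s1 i • C.slot i + (if i = i₀ then (C.r i₀ k s0 s1 : ℤ) • C.dir i₀ k s0 s1 else 0))) := by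
  unfold FanCert.check at hV
  exact of_decide_eq_true hV

/-- Fan bookkeeping (no vectors): nonnegative coordinates `(u, v)` lie in the cone of two CONSECUTIVE
fan directions, with explicit nonnegative coefficients. -/
theorem fan_coeffs (hV : C.check = true) {u v : ℝ} (hu : 0 ≤ u) (hv : 0 ≤ v) :
    ∃ k k' : Fin C.K, k'.val = k.val + 1 ∧ 0 < C.alpha k ∧ 0 < C.beta k' ∧
      ∃ x y : ℝ, 0 ≤ x ∧ 0 ≤ y ∧
        x * (C.alpha k : ℝ) + y * (C.alpha k' : ℝ) = u ∧ x * (C.beta k : ℝ) + y * (C.beta k' : ℝ) = v := by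
  classical
  obtain ⟨-, hK, -, -, -, -, -, -, hends, hcons, -⟩ := C.check_spec hV
  have hK0 : 0 < C.K := by omega
  have hKl : C.K - 1 < C.K := by omega
  -- the slope sequence
  let f : ℕ → ℝ := fun n => if h : n < C.K then (C.alpha ⟨n, h⟩ : ℝ) * v - (C.beta ⟨n, h⟩ : ℝ) * u else 0
  have hf0 : 0 ≤ f 0 := by
    have h := (hends ⟨0, hK0⟩).1 rfl
    show 0 ≤ (if h : 0 < C.K then (C.alpha ⟨0, h⟩ : ℝ) * v - (C.beta ⟨0, h⟩ : ℝ) * u else 0)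
    rw [dif_pos hK0, h.1, h.2]; simp; exact hv
  have hfl : f (C.K - 1) ≤ 0 := by
    have h := (hends ⟨C.K - 1, hKl⟩).2 rfl
    show (if h : C.K - 1 < C.K then (C.alpha ⟨C.K - 1, h⟩ : ℝ) * v - (C.beta ⟨C.K - 1, h⟩ : ℝ) * u else 0) ≤ 0
    rw [dif_pos hKl, h.1, h.2]; simp; exact hu
  obtain ⟨kk, hkk, hfk, hfk'⟩ := exists_consecutive_sign_change hK f hf0 hfl
  have hkK : kk < C.K := by omega
  have hfk1 : 0 ≤ (C.alpha ⟨kk, hkK⟩ : ℝ) * v - (C.beta ⟨kk, hkK⟩ : ℝ) * u := by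
    have : f kk = (C.alpha ⟨kk, hkK⟩ : ℝ) * v - (C.beta ⟨kk, hkK⟩ : ℝ) * u := dif_pos hkK
    rw [← this]; exact hfk
  have hfk2 : (C.alpha ⟨kk + 1, hkk⟩ : ℝ) * v - (C.beta ⟨kk + 1, hkk⟩ : ℝ) * u ≤ 0 := by
    have : f (kk + 1) = (C.alpha ⟨kk + 1, hkk⟩ : ℝ) * v - (C.beta ⟨kk + 1, hkk⟩ : ℝ) * u := dif_pos hkk
    rw [← this]; exact hfk'
  obtain ⟨hdet, -⟩ := hcons ⟨kk, hkK⟩ ⟨kk + 1, hkk⟩ rfl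
  refine ⟨⟨kk, hkK⟩, ⟨kk + 1, hkk⟩, rfl, ?_, ?_, ?_⟩
  · rcases Nat.eq_zero_or_pos (C.alpha ⟨kk, hkK⟩) with h | h
    · rw [h] at hdet; simp at hdet
    · exact h
  · rcases Nat.eq_zero_or_pos (C.beta ⟨kk + 1, hkk⟩) with h | h
    · rw [h] at hdet; simp at hdet
    · exact h
  -- explicit coefficients
  have hdetR : (C.alpha ⟨kk + 1, hkk⟩ : ℝ) * (C.beta ⟨kk, hkK⟩ : ℝ) <
      (C.alpha ⟨kk, hkK⟩ : ℝ) * (C.beta ⟨kk + 1, hkk⟩ : ℝ) := by exact_mod_cast hdet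
  generalize hαg : (C.alpha ⟨kk, hkK⟩ : ℝ) = α at hdetR hfk1 ⊢
  generalize hβg : (C.beta ⟨kk, hkK⟩ : ℝ) = β at hdetR hfk1 ⊢
  generalize hα'g : (C.alpha ⟨kk + 1, hkk⟩ : ℝ) = α' at hdetR hfk2 ⊢
  generalize hβ'g : (C.beta ⟨kk + 1, hkk⟩ : ℝ) = β' at hdetR hfk2 ⊢
  have hdetpos : 0 < α * β' - α' * β := by linarith
  have hdetne : α * β' - α' * β ≠ 0 := hdetpos.ne'
  refine ⟨(u * β' - v * α') / (α * β' - α' * β), (v * α - u * β) / (α * β' - α' * β),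
    div_nonneg (by linarith) hdetpos.le, div_nonneg (by linarith) hdetpos.le, ?_, ?_⟩
  · rw [div_mul_eq_mul_div, div_mul_eq_mul_div, ← add_div, div_eq_iff hdetne]; ring
  · rw [div_mul_eq_mul_div, div_mul_eq_mul_div, ← add_div, div_eq_iff hdetne]; ring

set_option maxHeartbeats 400000 in
/-- **The covering step.**  For a valid fan certificate, every tangent vector `w` at ball `i₀`
(`⟪w, slot⟫ = 0`) is within the covering constant of some signed fan direction `D`:
`⟪w, D⟫ ≥ 0` and `Cd ‖w‖² ‖D‖² ≤ Cn ⟪w, D⟫²`. -/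
theorem exists_fan_dir (hV : C.check = true) (i₀ : Fin m) (w : EuclideanSpace ℝ (Fin 3))
    (hw : ⟪w, intVec (C.slot i₀)⟫ = 0) :
    ∃ k : Fin C.K, ∃ s0 s1 : Bool,
      0 ≤ ⟪w, intVec (C.dir i₀ k s0 s1)⟫ ∧
      (C.Cd : ℝ) * (‖w‖ ^ 2 * ‖intVec (C.dir i₀ k s0 s1)‖ ^ 2) ≤
        (C.Cn : ℝ) * ⟪w, intVec (C.dir i₀ k s0 s1)⟫ ^ 2 ∧
      intVec (C.dir i₀ k s0 s1) ≠ 0 := by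
  classical
  obtain ⟨hN, hK, hCn, hCd, -, -, -, htan, -, hcons, -⟩ := C.check_spec hV
  obtain ⟨hS0, hT0, hT1, hST0, hST1, hT01⟩ := htan i₀
  have hCdR : (0 : ℝ) < C.Cd := by exact_mod_cast hCd
  have hCnR : (0 : ℝ) < C.Cn := by exact_mod_cast hCn
  -- signs of the two tangent coordinates
  have hsign : ∀ x : ℝ, ∃ s : Bool, 0 ≤ (ConeCert.sgn s : ℝ) * x := by
    intro x
    rcases le_or_gt 0 x with h | h
    · exact ⟨true, by rw [ConeCert.sgn_true, Int.cast_one, one_mul]; exact h⟩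
    · exact ⟨false, by rw [ConeCert.sgn_false, Int.cast_neg, Int.cast_one]; linarith⟩
  obtain ⟨s0, hs0⟩ := hsign ⟪w, intVec (C.tau i₀ 0)⟫
  obtain ⟨s1, hs1⟩ := hsign ⟪w, intVec (C.tau i₀ 1)⟫
  have hσ00 : (ConeCert.sgn s0 : ℝ) * (ConeCert.sgn s0 : ℝ) = 1 := sgn_mul_sgn_real s0
  have hσ11 : (ConeCert.sgn s1 : ℝ) * (ConeCert.sgn s1 : ℝ) = 1 := sgn_mul_sgn_real s1
  have hn0pos : 0 < ‖intVec (C.tau i₀ 0)‖ ^ 2 := by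
    have := intVec_ne_zero hT0; positivity
  have hn1pos : 0 < ‖intVec (C.tau i₀ 1)‖ ^ 2 := by
    have := intVec_ne_zero hT1; positivity
  -- frame decomposition of w
  have hwdec := eq_frame_combination (intVec_ne_zero hS0) (intVec_ne_zero hT0) (intVec_ne_zero hT1)
    (by rw [inner_intVec]; exact_mod_cast hST0) (by rw [inner_intVec]; exact_mod_cast hST1)
    (by rw [inner_intVec]; exact_mod_cast hT01) hw
  -- the consecutive pair and coefficients
  obtain ⟨k, k', hkk', hαk, hβk', x, y, hx, hy, hxu, hyv⟩ := C.fan_coeffs hV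
    (u := (ConeCert.sgn s0 : ℝ) * ⟪w, intVec (C.tau i₀ 0)⟫ / ‖intVec (C.tau i₀ 0)‖ ^ 2)
    (v := (ConeCert.sgn s1 : ℝ) * ⟪w, intVec (C.tau i₀ 1)⟫ / ‖intVec (C.tau i₀ 1)‖ ^ 2)
    (div_nonneg hs0 hn0pos.le) (div_nonneg hs1 hn1pos.le)
  obtain ⟨hdet, hcov⟩ := hcons k k' hkk'
  -- the two directions and their metric data (reals)
  have hn0 : (dotInt (C.tau i₀ 0) (C.tau i₀ 0) : ℝ) = ‖intVec (C.tau i₀ 0)‖ ^ 2 := by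
    rw [← real_inner_self_eq_norm_sq, inner_intVec]
  have hn1 : (dotInt (C.tau i₀ 1) (C.tau i₀ 1) : ℝ) = ‖intVec (C.tau i₀ 1)‖ ^ 2 := by
    rw [← real_inner_self_eq_norm_sq, inner_intVec]
  have hPdef := C.intVec_dir i₀ k s0 s1
  have hQdef := C.intVec_dir i₀ k' s0 s1
  have hPPd : (C.ddot i₀ k k : ℝ) = ‖intVec (C.dir i₀ k s0 s1)‖ ^ 2 := by
    rw [← real_inner_self_eq_norm_sq, C.inner_dir_dir k k s0 s1 hT01]
  have hQQd : (C.ddot i₀ k' k' : ℝ) = ‖intVec (C.dir i₀ k' s0 s1)‖ ^ 2 := by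
    rw [← real_inner_self_eq_norm_sq, C.inner_dir_dir k' k' s0 s1 hT01]
  have hPQd : (C.ddot i₀ k k' : ℝ) = ⟪intVec (C.dir i₀ k s0 s1), intVec (C.dir i₀ k' s0 s1)⟫ := by
    rw [C.inner_dir_dir k k' s0 s1 hT01]
  have hPP : ‖intVec (C.dir i₀ k s0 s1)‖ ^ 2 =
      (C.alpha k : ℝ) ^ 2 * ‖intVec (C.tau i₀ 0)‖ ^ 2 + (C.beta k : ℝ) ^ 2 * ‖intVec (C.tau i₀ 1)‖ ^ 2 := by
    rw [← hPPd, FanCert.ddot]; push_cast; rw [hn0, hn1]; ring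
  have hQQ : ‖intVec (C.dir i₀ k' s0 s1)‖ ^ 2 =
      (C.alpha k' : ℝ) ^ 2 * ‖intVec (C.tau i₀ 0)‖ ^ 2 + (C.beta k' : ℝ) ^ 2 * ‖intVec (C.tau i₀ 1)‖ ^ 2 := by
    rw [← hQQd, FanCert.ddot]; push_cast; rw [hn0, hn1]; ring
  have hPQ : ⟪intVec (C.dir i₀ k s0 s1), intVec (C.dir i₀ k' s0 s1)⟫ =
      (C.alpha k : ℝ) * (C.alpha k' : ℝ) * ‖intVec (C.tau i₀ 0)‖ ^ 2 +
        (C.beta k : ℝ) * (C.beta k' : ℝ) * ‖intVec (C.tau i₀ 1)‖ ^ 2 := by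
    rw [← hPQd, FanCert.ddot]; push_cast; rw [hn0, hn1]
  -- the integer covering clause in reals
  have hcovR : 2 * C.Cd ≤ C.Cn ∨
      (2 * (C.Cd : ℝ) - C.Cn) ^ 2 * ‖intVec (C.dir i₀ k s0 s1)‖ ^ 2 * ‖intVec (C.dir i₀ k' s0 s1)‖ ^ 2 ≤
        (C.Cn : ℝ) ^ 2 * ⟪intVec (C.dir i₀ k s0 s1), intVec (C.dir i₀ k' s0 s1)⟫ ^ 2 := by
    rcases hcov i₀ with h | h
    · exact Or.inl h
    · right
      have h' : (2 * (C.Cd : ℝ) - C.Cn) ^ 2 * (C.ddot i₀ k k : ℝ) * (C.ddot i₀ k' k' : ℝ) ≤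
          (C.Cn : ℝ) ^ 2 * (C.ddot i₀ k k' : ℝ) ^ 2 := by exact_mod_cast h
      rw [hPPd, hQQd, hPQd] at h'; exact h'
  -- generalize everything to opaque names
  generalize hPg : intVec (C.dir i₀ k s0 s1) = P at hPdef hPP hQQ hPQ hcovR
  generalize hQg : intVec (C.dir i₀ k' s0 s1) = Q at hQdef hQQ hPQ hcovR
  generalize hT0g : intVec (C.tau i₀ 0) = T0 at hwdec hPdef hQdef hs0 hn0pos hxu hyv hPP hQQ hPQ
  generalize hT1g : intVec (C.tau i₀ 1) = T1 at hwdec hPdef hQdef hs1 hn1pos hxu hyv hPP hQQ hPQ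
  generalize hσ0g : (ConeCert.sgn s0 : ℝ) = σ0 at hσ00 hs0 hPdef hQdef hxu hyv
  generalize hσ1g : (ConeCert.sgn s1 : ℝ) = σ1 at hσ11 hs1 hPdef hQdef hxu hyv
  generalize hαg : (C.alpha k : ℝ) = α at hPdef hxu hyv hPP hPQ
  generalize hβg : (C.beta k : ℝ) = β at hPdef hxu hyv hPP hPQ
  generalize hα'g : (C.alpha k' : ℝ) = α' at hQdef hxu hyv hQQ hPQ
  generalize hβ'g : (C.beta k' : ℝ) = β' at hQdef hxu hyv hQQ hPQ
  have hαpos : 0 < α := by rw [← hαg]; exact_mod_cast hαk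
  have hβ'pos : 0 < β' := by rw [← hβ'g]; exact_mod_cast hβk'
  have hα'0 : 0 ≤ α' := by rw [← hα'g]; positivity
  have hβ0 : 0 ≤ β := by rw [← hβg]; positivity
  -- w in the cone of (P, Q)
  have hW : w = x • P + y • Q := by
    have h1 : x • P + y • Q = (σ0 * (x * α + y * α')) • T0 + (σ1 * (x * β + y * β')) • T1 := by
      rw [hPdef, hQdef]; module
    have e0 : σ0 * (σ0 * ⟪w, T0⟫ / ‖T0‖ ^ 2) = ⟪w, T0⟫ / ‖T0‖ ^ 2 := by
      rw [← mul_div_assoc, ← mul_assoc, hσ00, one_mul]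
    have e1 : σ1 * (σ1 * ⟪w, T1⟫ / ‖T1‖ ^ 2) = ⟪w, T1⟫ / ‖T1‖ ^ 2 := by
      rw [← mul_div_assoc, ← mul_assoc, hσ11, one_mul]
    rw [h1, hxu, hyv, e0, e1]
    exact hwdec
  have hPne : P ≠ 0 := by
    intro h
    have h0 : ‖P‖ ^ 2 = 0 := by rw [h, norm_zero, sq, mul_zero]
    rw [hPP] at h0
    have h1 : 0 < α ^ 2 * ‖T0‖ ^ 2 := mul_pos (pow_pos hαpos 2) hn0pos
    have h2 : 0 ≤ β ^ 2 * ‖T1‖ ^ 2 := mul_nonneg (sq_nonneg β) hn1pos.le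
    linarith
  have hQne : Q ≠ 0 := by
    intro h
    have h0 : ‖Q‖ ^ 2 = 0 := by rw [h, norm_zero, sq, mul_zero]
    rw [hQQ] at h0
    have h1 : 0 < β' ^ 2 * ‖T1‖ ^ 2 := mul_pos (pow_pos hβ'pos 2) hn1pos
    have h2 : 0 ≤ α' ^ 2 * ‖T0‖ ^ 2 := mul_nonneg (sq_nonneg α') hn0pos.le
    linarith
  have hPQ0 : 0 ≤ ⟪P, Q⟫ := by
    rw [hPQ]
    exact add_nonneg (mul_nonneg (mul_nonneg hαpos.le hα'0) hn0pos.le)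
      (mul_nonneg (mul_nonneg hβ0 hβ'pos.le) hn1pos.le)
  obtain ⟨D, hDPQ, hwD, hcov2⟩ := cover_two hPne hQne hx hy hW hPQ0
  have hpq : 0 < ‖P‖ * ‖Q‖ := mul_pos (norm_pos_iff.2 hPne) (norm_pos_iff.2 hQne)
  -- the covering constant
  have hconst : (C.Cd : ℝ) * (‖w‖ ^ 2 * ‖D‖ ^ 2) ≤ (C.Cn : ℝ) * ⟪w, D⟫ ^ 2 := by
    have hwD2 : 0 ≤ ‖w‖ ^ 2 * ‖D‖ ^ 2 := by positivity
    by_cases hA : 2 * C.Cd ≤ C.Cn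
    · have hAR : 2 * (C.Cd : ℝ) ≤ C.Cn := by exact_mod_cast hA
      have h1 : ‖w‖ ^ 2 * ‖D‖ ^ 2 * (‖P‖ * ‖Q‖) ≤ 2 * ⟪w, D⟫ ^ 2 * (‖P‖ * ‖Q‖) := by
        have : ‖w‖ ^ 2 * ‖D‖ ^ 2 * (‖P‖ * ‖Q‖) ≤ ‖w‖ ^ 2 * ‖D‖ ^ 2 * (‖P‖ * ‖Q‖ + ⟪P, Q⟫) := by
          have := mul_nonneg hwD2 hPQ0; linarith
        linarith
      have h2 : ‖w‖ ^ 2 * ‖D‖ ^ 2 ≤ 2 * ⟪w, D⟫ ^ 2 := le_of_mul_le_mul_right h1 hpq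
      have h3 : (C.Cd : ℝ) * (‖w‖ ^ 2 * ‖D‖ ^ 2) ≤ (C.Cd : ℝ) * (2 * ⟪w, D⟫ ^ 2) :=
        mul_le_mul_of_nonneg_left h2 hCdR.le
      have h4 : (C.Cd : ℝ) * (2 * ⟪w, D⟫ ^ 2) ≤ (C.Cn : ℝ) * ⟪w, D⟫ ^ 2 := by
        have := sq_nonneg ⟪w, D⟫; nlinarith
      linarith
    · have hB := hcovR.resolve_left hA
      have hAR : (C.Cn : ℝ) < 2 * C.Cd := by
        have : C.Cn < 2 * C.Cd := not_le.mp hA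
        exact_mod_cast this
      -- square roots: (2Cd − Cn) ‖P‖‖Q‖ ≤ Cn ⟪P,Q⟫
      have hγ0 : 0 ≤ (2 * (C.Cd : ℝ) - C.Cn) * (‖P‖ * ‖Q‖) := mul_nonneg (by linarith) hpq.le
      have hsq : ((2 * (C.Cd : ℝ) - C.Cn) * (‖P‖ * ‖Q‖)) ^ 2 ≤ ((C.Cn : ℝ) * ⟪P, Q⟫) ^ 2 := by
        have e1 : ((2 * (C.Cd : ℝ) - C.Cn) * (‖P‖ * ‖Q‖)) ^ 2 =
            (2 * (C.Cd : ℝ) - C.Cn) ^ 2 * ‖P‖ ^ 2 * ‖Q‖ ^ 2 := by ring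
        have e2 : ((C.Cn : ℝ) * ⟪P, Q⟫) ^ 2 = (C.Cn : ℝ) ^ 2 * ⟪P, Q⟫ ^ 2 := by ring
        rw [e1, e2]; exact hB
      have hroot : (2 * (C.Cd : ℝ) - C.Cn) * (‖P‖ * ‖Q‖) ≤ (C.Cn : ℝ) * ⟪P, Q⟫ :=
        (pow_le_pow_iff_left₀ hγ0 (mul_nonneg hCnR.le hPQ0) two_ne_zero).1 hsq
      have h3 : 2 * (C.Cd : ℝ) * (‖P‖ * ‖Q‖) ≤ (C.Cn : ℝ) * (‖P‖ * ‖Q‖ + ⟪P, Q⟫) := by linarith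
      have h4 : (C.Cn : ℝ) * (‖w‖ ^ 2 * ‖D‖ ^ 2 * (‖P‖ * ‖Q‖ + ⟪P, Q⟫)) ≤
          (C.Cn : ℝ) * (2 * ⟪w, D⟫ ^ 2 * (‖P‖ * ‖Q‖)) := mul_le_mul_of_nonneg_left hcov2 hCnR.le
      have h6 : 2 * (C.Cd : ℝ) * (‖P‖ * ‖Q‖) * (‖w‖ ^ 2 * ‖D‖ ^ 2) ≤
          (C.Cn : ℝ) * (‖P‖ * ‖Q‖ + ⟪P, Q⟫) * (‖w‖ ^ 2 * ‖D‖ ^ 2) :=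
        mul_le_mul_of_nonneg_right h3 hwD2
      have h5 : 2 * (C.Cd : ℝ) * (‖P‖ * ‖Q‖) * (‖w‖ ^ 2 * ‖D‖ ^ 2) ≤
          (C.Cn : ℝ) * (2 * ⟪w, D⟫ ^ 2 * (‖P‖ * ‖Q‖)) := by linarith
      have h7 : (‖P‖ * ‖Q‖) * (2 * ((C.Cd : ℝ) * (‖w‖ ^ 2 * ‖D‖ ^ 2))) ≤
          (‖P‖ * ‖Q‖) * (2 * ((C.Cn : ℝ) * ⟪w, D⟫ ^ 2)) := by linarith
      have h8 := le_of_mul_le_mul_left h7 hpq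
      linarith
  rcases hDPQ with hDP | hDQ
  · rw [hDP] at hwD hconst
    refine ⟨k, s0, s1, ?_, ?_, ?_⟩ <;> rw [hPg]
    exacts [hwD, hconst, hPne]
  · rw [hDQ] at hwD hconst
    refine ⟨k', s0, s1, ?_, ?_, ?_⟩ <;> rw [hQg]
    exacts [hwD, hconst, hQne]

end FanCert

end Summit.Ventures.Crystal3D.Theorems

end
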